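import Mathlib.AlgebraicGeometry.Morphisms.FlatRank
import Mathlib.AlgebraicGeometry.IdealSheaf.Functorial
import Mathlib.AlgebraicGeometry.Pullbacks
import Mathlib.CategoryTheory.Monoidal.Cartesian.Over
import HarnessLib

/-!
# The Hilbert functor of points `Hilb^n_{X/B}` and Hilbert schemes of `n` points

Layer `Literature/AlgebraicGeometry/HilbertScheme`. Written for the definition item
`defn-IsOfK3HilbertSquareType` (hyperkähler manifolds of `K3^[n]`-type are the deformations of the
Hilbert scheme `S^[n]` of `n` points on a K3 surface `S`; that notion lives in
`Literature/AlgebraicGeometry/Hyperkaehler/K3HilbertType.lean` and imports this file), but kept in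
Mathlib generality: an arbitrary base scheme `B`, an arbitrary `B`-scheme `X`, arbitrary `n`.

## Sources (read)

* The Stacks Project, Tag 0B94 (Section "Hilbert scheme of points"), verbatim: "Let `X → S` be a
  morphism of schemes. Let `d ≥ 0` be an integer. For a scheme `T` over `S` we let
  `Hilb^d_{X/S}(T) = { Z ⊂ X_T closed subscheme such that Z → T is finite locally free of degree d }`.
  If `T' → T` is a morphism of schemes over `S` and if `Z ∈ Hilb^d_{X/S}(T)`, then the base change
  `Z_{T'} ⊂ X_{T'}` is an element of `Hilb^d_{X/S}(T')`. In this way we obtain a functor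
  `Hilb^d_{X/S} : (Sch/S)^opp → Sets`. […] If `Hilb^d_{X/S}` is representable by a scheme, we often
  denote this scheme by `\underline{Hilb}^d_{X/S}`." Lemma 0B95 (fpqc sheaf), Proposition 0B9A
  ("Assume for all `(s, x₁, …, x_d)` […] there exists an affine open `U ⊂ X` with
  `x₁, …, x_d ∈ U`. Then `Hilb^d_{X/S}` is representable by a scheme.") and Remark 0B9B (this
  holds e.g. for `X → S` quasi-projective).
* The Stacks Project, Tag 02KA (Definition: `f : X → S` is *finite locally free* if `f` is affine
  and `f_*𝒪_X` is a finite locally free `𝒪_S`-module; `f` has *rank* or *degree* `d` if `f_*𝒪_X`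
  is finite locally free of degree `d`) and Tag 02KB (Lemma: `f` is finite locally free iff `f` is
  finite, flat and locally of finite presentation).
* N. Nitsure, *Construction of Hilbert and Quot schemes* (FGA explained), arXiv:math/0504590,
  Thm. 5.1 (Grothendieck): for `S` noetherian and `X → S` projective the Quot/Hilbert functors
  with fixed Hilbert polynomial are representable by projective `S`-schemes — the Hilbert scheme
  of `n` points is the case of the constant Hilbert polynomial `n`.
* A. Beauville, J. Differential Geom. 18 (1983), §6 (p. 765): "On notera `S^[r]` l'espace de
  Douady (ou schéma de Hilbert…) qui paramètre les sous-espaces analytiques finis `Z ⊂ S` avec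
  `lg(𝒪_Z) = r`", with the list (a)–(f) of its properties after Fogarty (for a smooth surface `S`,
  `S^[r] → S^(r)` is a resolution of singularities; `S^[r]` is smooth of dimension `2r`).

## Rendering (Mathlib carriers) and design

Everything is phrased in Mathlib's category `Over B` of `B`-schemes with its cartesian monoidal
structure (`Mathlib.AlgebraicGeometry.Pullbacks`: `X ⊗ T` is the fibre product `X ×_B T`,
`(X ⊗ T).left = pullback X.hom T.hom`, `snd X T` its second projection, and for `g : T' ⟶ T` the
whiskered map `X ◁ g : X ⊗ T' ⟶ X ⊗ T` is `X ×_B g`); the tree's `Motives.SchemeOver k` is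
`Over (Spec k)`, so every definition applies verbatim to `k`-schemes.

* CLOSED SUBSCHEMES `Z ⊂ X_T` are Mathlib's ideal sheaves `I : (X ⊗ T).left.IdealSheafData`
  (quasi-coherent ideals; `I.subscheme`, the closed immersion `I.subschemeι : I.subscheme ⟶ X_T`,
  and `I.subschemeι.ker = I`, `Scheme.IdealSheafData.ker_subschemeι`; conversely every closed
  immersion is the subscheme of its kernel up to unique isomorphism). Using the ideal (not a closed
  immersion up to isomorphism) makes `Hilb^n_{X/B}(T)` an honest SET and "`Z_{T'} = Z'`" an
  honest EQUALITY. BASE CHANGE of `Z` along `g : T' ⟶ T` is `I.comap (X ◁ g).left`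
  (`Scheme.IdealSheafData.comap`, the kernel of the pulled-back closed immersion; functorial:
  `comap_comp`, `comap_id`).
* FINITE LOCALLY FREE OF DEGREE `n` (`IsFiniteLocallyFreeOfRank n p`): `p` finite, flat and
  locally of finite presentation (Stacks 02KB: ⟺ finite locally free) with Mathlib's rank function
  `Scheme.Hom.finrank p : T → ℕ` (the rank of `p_*𝒪_Z` over `𝒪_T` at `t`, Stacks 02KA) constant
  `= n`.
* `hilbertFunctorOfPoints n X T = Hilb^n_{X/B}(T)`, the set of `I` with `Z_I → T` finite locally
  free of degree `n`; `comap_whiskerLeft_mem` PROVES the functoriality sentence of Tag 0B94 (base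
  change preserves membership: the pulled-back subscheme is the fibre product `Z ×_T T'`, by pasting
  of pullback squares, and finiteness / flatness / finite presentation / the rank are stable under
  base change — Mathlib).
* `IsHilbertSchemeOfPoints n X H Ξ`: **the pair `(H, Ξ)` represents `Hilb^n_{X/B}`** — `Ξ` is a
  `H`-point of the functor (the UNIVERSAL FAMILY `Ξ ⊂ X ×_B H`) and for every `B`-scheme `T` and
  every `I ∈ Hilb^n_{X/B}(T)` there is a unique `B`-morphism `g : T ⟶ H` with `(X ×_B g)^* Ξ = I`.
  By Yoneda this is exactly "the natural transformation `h_H → Hilb^n_{X/B}`, `g ↦ g^*Ξ`, is an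
  isomorphism", i.e. `H = \underline{Hilb}^n_{X/B}` with its universal family; the pair is unique
  up to a unique isomorphism respecting the families (`IsHilbertSchemeOfPoints.exists_iso`).
  A predicate on data `(H, Ξ)` rather than a construction: the EXISTENCE of the Hilbert scheme
  (Grothendieck; Stacks 0B9A/0B9B) is a theorem about this predicate, not part of it (see below).

## API (all proved)

`IsFiniteLocallyFreeOfRank.iff`, `.of_isPullback` (base change), `.iso_comp_iff`;
`isPullback_whiskerLeft` (`X ×_B T' = (X ×_B T) ×_T T'`); `mem_hilbertFunctorOfPoints_iff`,
`comap_whiskerLeft_mem` (functoriality of `Hilb^n_{X/B}`); for `h : IsHilbertSchemeOfPoints n X H Ξ`: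
`comap_whiskerLeft_comp`, `comap_whiskerLeft_id`, `h.hom_ext` (maps to `H` are determined by the
pulled-back family), `h.lift` (the classifying morphism of a family) with `h.comap_lift`,
`h.eq_lift`, `h.lift_self` (`Ξ` is classified by `𝟙 H`), `h.exists_iso` (uniqueness of the
representing pair). NON-VACUITY: `isHilbertSchemeOfPoints_zero` — **`Hilb^0_{X/B}` is represented by
`B` itself** (`𝟙_ (Over B)`) with the EMPTY family `⊤` (Stacks 0B94 with `d = 0`: the only closed
subscheme of `X_T` finite locally free of degree `0` over `T` is `∅`, `mem_hilbertFunctorOfPoints_zero_iff`),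
via `isOpenImmersion_of_isEmpty`, `finrank_eq_zero_of_isEmpty`, `isFiniteLocallyFreeOfRank_zero_of_isEmpty`
and `IsFiniteLocallyFreeOfRank.isEmpty` (rank `0` everywhere ⟺ empty source).

## Not here

The existence theorems (Grothendieck, FGA no. 221 / Nitsure Thm. 5.1: `X → B` projective, `B`
noetherian ⟹ representable by a projective `B`-scheme; Stacks 0B9A/0B9B) — to be vendored as named
facts against `IsHilbertSchemeOfPoints` by whoever needs them; Hilbert schemes for a general
Hilbert polynomial and Quot schemes (Mathlib has no Hilbert polynomial / Euler characteristic of a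
coherent sheaf); the Hilbert–Chow morphism `S^[n] → S^(n)`; Fogarty's theorem (for a smooth
quasi-projective surface `S`, `S^[n]` is smooth irreducible of dimension `2n`) and Beauville's
description `S^[2] = Bl_Δ(S × S)/𝔖₂`.
-/

noncomputable section

open CategoryTheory Limits MonoidalCategory AlgebraicGeometry

universe u

namespace Literature.AlgebraicGeometry.HilbertScheme

/-! ### Finite locally free morphisms of degree `n` -/

/-- **`p : Z ⟶ T` is finite locally free of rank (= degree) `n`** (Stacks 02KA): `p` is finite,
flat and locally of finite presentation — equivalently (Stacks 02KB) `p` is affine and `p_*𝒪_Z`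
is a finite locally free `𝒪_T`-module — and the rank of `p_*𝒪_Z` at every point of `T`
(Mathlib's `Scheme.Hom.finrank`, a locally constant function for such `p`) is `n`.
[cite: StacksProject, Tag 02KA and Tag 02KB] -/
structure IsFiniteLocallyFreeOfRank (n : ℕ) {Z T : Scheme.{u}} (p : Z ⟶ T) : Prop where
  /-- `p` is finite. -/
  isFinite : IsFinite p
  /-- `p` is flat. -/
  flat : Flat p
  /-- `p` is locally of finite presentation. -/
  locallyOfFinitePresentation : LocallyOfFinitePresentation p
  /-- The rank of `p_*𝒪_Z` is `n` at every point of `T`. -/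
  finrank_eq : ∀ t : T, p.finrank t = n

namespace IsFiniteLocallyFreeOfRank

variable {n : ℕ} {Z T : Scheme.{u}} {p : Z ⟶ T}

/-- Unfolding lemma. [cite: StacksProject, Tag 02KA and Tag 02KB] -/
theorem iff : IsFiniteLocallyFreeOfRank n p ↔
    IsFinite p ∧ Flat p ∧ LocallyOfFinitePresentation p ∧ ∀ t : T, p.finrank t = n :=
  ⟨fun h ↦ ⟨h.1, h.2, h.3, h.4⟩, fun h ↦ ⟨h.1, h.2.1, h.2.2.1, h.2.2.2⟩⟩

/-- **Stability under base change**: in a pullback square with `p` on the right and `p'` on the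
left, if `p` is finite locally free of rank `n` then so is `p'` (finiteness, flatness and finite
presentation are stable under base change, and the rank function pulls back).
[cite: StacksProject, Tag 02KA and Tag 02KB] -/
theorem of_isPullback {Z' T' : Scheme.{u}} {p' : Z' ⟶ T'} {g' : Z' ⟶ Z} {g : T' ⟶ T}
    (sq : IsPullback g' p' p g) (h : IsFiniteLocallyFreeOfRank n p) :
    IsFiniteLocallyFreeOfRank n p' := by
  haveI := h.isFinite
  haveI := h.flat
  haveI := h.locallyOfFinitePresentation
  refine ⟨MorphismProperty.of_isPullback sq ‹_›, MorphismProperty.of_isPullback sq ‹_›,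
    MorphismProperty.of_isPullback sq ‹_›, fun t ↦ ?_⟩
  rw [Scheme.Hom.finrank_of_isPullback g' p' p g sq t, h.finrank_eq]

/-- Invariance under isomorphisms of the source: `e ≫ p` is finite locally free of rank `n` iff
`p` is, for `e` an isomorphism. [folklore] -/
theorem iso_comp_iff {Z' : Scheme.{u}} (e : Z' ⟶ Z) [IsIso e] :
    IsFiniteLocallyFreeOfRank n (e ≫ p) ↔ IsFiniteLocallyFreeOfRank n p := by
  constructor
  · intro h
    haveI := h.isFinite
    haveI := h.flat
    haveI := h.locallyOfFinitePresentation
    haveI : IsFinite p := (MorphismProperty.cancel_left_of_respectsIso @IsFinite e p).mp ‹_›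
    haveI : Flat p := (MorphismProperty.cancel_left_of_respectsIso @Flat e p).mp ‹_›
    haveI : LocallyOfFinitePresentation p :=
      (MorphismProperty.cancel_left_of_respectsIso @LocallyOfFinitePresentation e p).mp ‹_›
    refine ⟨‹_›, ‹_›, ‹_›, fun t ↦ ?_⟩
    rw [← Scheme.Hom.finrank_comp_left_of_isIso e p, h.finrank_eq]
  · intro h
    haveI := h.isFinite
    haveI := h.flat
    haveI := h.locallyOfFinitePresentation
    refine ⟨inferInstance, inferInstance, inferInstance, fun t ↦ ?_⟩
    rw [Scheme.Hom.finrank_comp_left_of_isIso e p, h.finrank_eq]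

end IsFiniteLocallyFreeOfRank

/-! ### The Hilbert functor of points -/

variable {B : Scheme.{u}}

open SemiCartesianMonoidalCategory in
/-- For a `B`-scheme `X` and a `B`-morphism `g : T' ⟶ T`, the square
`X ×_B T' → T'`, `X ×_B T → T` with vertical maps `X ×_B g` and `g` is cartesian:
`X ×_B T' = (X ×_B T) ×_T T'` (pasting of pullback squares). This is what makes base change of
families of subschemes of `X` the base change of schemes over `T`. [folklore] -/
theorem isPullback_whiskerLeft (X : Over B) {T' T : Over B} (g : T' ⟶ T) :
    IsPullback (snd X T').left (X ◁ g).left g.left (snd X T).left := by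
  have t : IsPullback (snd X T).left (fst X T).left T.hom X.hom :=
    (IsPullback.of_hasPullback X.hom T.hom).flip
  have s : IsPullback (snd X T').left (fst X T').left T'.hom X.hom :=
    (IsPullback.of_hasPullback X.hom T'.hom).flip
  refine IsPullback.of_bot ?_ ?_ t
  · have h1 : (X ◁ g).left ≫ (fst X T).left = (fst X T').left :=
      Over.whiskerLeft_left_fst g
    have h2 : g.left ≫ T.hom = T'.hom := Over.w g
    rw [h1, h2]
    exact s
  · exact (Over.whiskerLeft_left_snd g).symm

open SemiCartesianMonoidalCategory in
/-- **The Hilbert functor of `n` points of `X → B` on `T`-points, `Hilb^n_{X/B}(T)`** (Stacks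
0B94): the set of closed subschemes `Z ⊂ X_T = X ×_B T` — as quasi-coherent ideal sheaves `I` of
`X ×_B T`, `Z = I.subscheme` — such that the projection `Z ↪ X ×_B T → T` is finite locally free
of degree `n`. [cite: StacksProject, Tag 0B94] -/
def hilbertFunctorOfPoints (n : ℕ) (X T : Over B) : Set (X ⊗ T).left.IdealSheafData :=
  {I | IsFiniteLocallyFreeOfRank n (I.subschemeι ≫ (snd X T).left)}

open SemiCartesianMonoidalCategory in
/-- Membership in `Hilb^n_{X/B}(T)`: `Z_I → T` is finite locally free of degree `n`.
[cite: StacksProject, Tag 0B94] -/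
theorem mem_hilbertFunctorOfPoints_iff {n : ℕ} {X T : Over B}
    (I : (X ⊗ T).left.IdealSheafData) :
    I ∈ hilbertFunctorOfPoints n X T ↔
      IsFiniteLocallyFreeOfRank n (I.subschemeι ≫ (snd X T).left) :=
  Iff.rfl

open SemiCartesianMonoidalCategory in
/-- **Functoriality of `Hilb^n_{X/B}`** (Stacks 0B94: "If `T' → T` is a morphism of schemes over
`S` and if `Z ∈ Hilb^d_{X/S}(T)`, then the base change `Z_{T'} ⊂ X_{T'}` is an element of
`Hilb^d_{X/S}(T')`"): the pulled-back ideal `I.comap (X ×_B g)` lies in `Hilb^n_{X/B}(T')`. Its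
subscheme is the fibre product `Z ×_{X_T} X_{T'} = Z ×_T T'` (`Scheme.IdealSheafData.comapIso`
and `isPullback_whiskerLeft`), and "finite locally free of degree `n`" is stable under base change.
[cite: StacksProject, Tag 0B94] -/
theorem comap_whiskerLeft_mem {n : ℕ} {X T T' : Over B} {I : (X ⊗ T).left.IdealSheafData}
    (hI : I ∈ hilbertFunctorOfPoints n X T) (g : T' ⟶ T) :
    I.comap (X ◁ g).left ∈ hilbertFunctorOfPoints n X T' := by
  set f := (X ◁ g).left
  have sq : IsPullback (pullback.snd f I.subschemeι)
      (pullback.fst f I.subschemeι ≫ (snd X T').left) (I.subschemeι ≫ (snd X T).left) g.left :=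
    ((IsPullback.of_hasPullback f I.subschemeι).paste_horiz (isPullback_whiskerLeft X g)).flip
  have key : IsFiniteLocallyFreeOfRank n (pullback.fst f I.subschemeι ≫ (snd X T').left) :=
    IsFiniteLocallyFreeOfRank.of_isPullback sq hI
  rw [mem_hilbertFunctorOfPoints_iff, ← Scheme.IdealSheafData.comapIso_hom_fst, Category.assoc,
    IsFiniteLocallyFreeOfRank.iso_comp_iff]
  exact key

/-! ### Hilbert schemes of points: representing pairs `(H, Ξ)` -/

/-- **`(H, Ξ)` is a Hilbert scheme of `n` points of `X` over `B`** (`H = \underline{Hilb}^n_{X/B}`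
with universal family `Ξ ⊂ X ×_B H`, Stacks 0B94; Grothendieck, FGA no. 221): `Ξ ∈ Hilb^n_{X/B}(H)`
and the pair REPRESENTS the Hilbert functor of points — for every `B`-scheme `T` and every
`I ∈ Hilb^n_{X/B}(T)` there is a unique `B`-morphism `g : T ⟶ H` with `(X ×_B g)^* Ξ = I`. By the
Yoneda lemma this says that `g ↦ g^*Ξ` is an isomorphism of functors `h_H ≅ Hilb^n_{X/B}` on
`(Sch/B)^op`. For `B = Spec ℂ`, `X = S` a smooth projective surface this is `S^[n]` (Fogarty;
Beauville 1983 §6: the scheme parametrising finite subschemes `Z ⊂ S` with `lg(𝒪_Z) = n`).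
Existence is NOT part of the predicate (see the module docstring).
[cite: StacksProject, Tag 0B94 and Proposition 0B9A] [cite: Nitsure2005, Thm. 5.1]
[cite: Beauville1983, §6] -/
structure IsHilbertSchemeOfPoints (n : ℕ) (X H : Over B) (Ξ : (X ⊗ H).left.IdealSheafData) :
    Prop where
  /-- The universal family is an `H`-point of `Hilb^n_{X/B}`: `Ξ → H` is finite locally free of
  degree `n`. -/
  mem : Ξ ∈ hilbertFunctorOfPoints n X H
  /-- Every `T`-point of `Hilb^n_{X/B}` is the pull-back of `Ξ` along a unique `B`-morphism
  `T ⟶ H`. -/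
  existsUnique_hom : ∀ (T : Over B), ∀ I ∈ hilbertFunctorOfPoints n X T,
    ∃! g : T ⟶ H, Ξ.comap (X ◁ g).left = I

namespace IsHilbertSchemeOfPoints

variable {n : ℕ} {X H : Over B} {Ξ : (X ⊗ H).left.IdealSheafData}

/-- Pulling back along a composite: `(X ×_B (g ≫ g'))^* Ξ = (X ×_B g)^* ((X ×_B g')^* Ξ)`.
[folklore] -/
theorem comap_whiskerLeft_comp (Ξ : (X ⊗ H).left.IdealSheafData) {T T' : Over B} (g : T' ⟶ T)
    (g' : T ⟶ H) :
    Ξ.comap (X ◁ (g ≫ g')).left = (Ξ.comap (X ◁ g').left).comap (X ◁ g).left := by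
  rw [MonoidalCategory.whiskerLeft_comp, Over.comp_left, Scheme.IdealSheafData.comap_comp]

/-- Pulling back along the identity does nothing. [folklore] -/
theorem comap_whiskerLeft_id (Ξ : (X ⊗ H).left.IdealSheafData) :
    Ξ.comap (X ◁ 𝟙 H).left = Ξ := by
  rw [MonoidalCategory.whiskerLeft_id, Over.id_left, Scheme.IdealSheafData.comap_id]

/-- Two `B`-morphisms `T ⟶ H` pulling back the universal family to the same subscheme are equal.
[cite: StacksProject, Tag 0B94] -/
theorem hom_ext (h : IsHilbertSchemeOfPoints n X H Ξ) {T : Over B} {g₁ g₂ : T ⟶ H}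
    (hg : Ξ.comap (X ◁ g₁).left = Ξ.comap (X ◁ g₂).left) : g₁ = g₂ :=
  (h.existsUnique_hom T _ (comap_whiskerLeft_mem h.mem g₂)).unique hg rfl

/-- **The classifying morphism** `T ⟶ H` of a family `I ∈ Hilb^n_{X/B}(T)`.
[cite: StacksProject, Tag 0B94] -/
def lift (h : IsHilbertSchemeOfPoints n X H Ξ) (T : Over B) (I : (X ⊗ T).left.IdealSheafData)
    (hI : I ∈ hilbertFunctorOfPoints n X T) : T ⟶ H :=
  (h.existsUnique_hom T I hI).exists.choose

/-- The classifying morphism pulls the universal family back to the given family.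
[cite: StacksProject, Tag 0B94] -/
theorem comap_lift (h : IsHilbertSchemeOfPoints n X H Ξ) (T : Over B)
    (I : (X ⊗ T).left.IdealSheafData) (hI : I ∈ hilbertFunctorOfPoints n X T) :
    Ξ.comap (X ◁ h.lift T I hI).left = I :=
  (h.existsUnique_hom T I hI).exists.choose_spec

/-- Any morphism pulling `Ξ` back to `I` is the classifying morphism of `I`.
[cite: StacksProject, Tag 0B94] -/
theorem eq_lift (h : IsHilbertSchemeOfPoints n X H Ξ) {T : Over B}
    {I : (X ⊗ T).left.IdealSheafData} (hI : I ∈ hilbertFunctorOfPoints n X T) {g : T ⟶ H}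
    (hg : Ξ.comap (X ◁ g).left = I) : g = h.lift T I hI :=
  h.hom_ext (hg.trans (h.comap_lift T I hI).symm)

/-- The universal family is classified by the identity of `H`. [folklore] -/
theorem lift_self (h : IsHilbertSchemeOfPoints n X H Ξ) : h.lift H Ξ h.mem = 𝟙 H :=
  (h.eq_lift h.mem (comap_whiskerLeft_id Ξ)).symm

/-- **Uniqueness of the Hilbert scheme**: two representing pairs `(H, Ξ)`, `(H', Ξ')` of
`Hilb^n_{X/B}` are isomorphic over `B` by an isomorphism exchanging the universal families
(Yoneda). [folklore] -/
theorem exists_iso {H' : Over B} {Ξ' : (X ⊗ H').left.IdealSheafData}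
    (h : IsHilbertSchemeOfPoints n X H Ξ) (h' : IsHilbertSchemeOfPoints n X H' Ξ') :
    ∃ e : H ≅ H', Ξ'.comap (X ◁ e.hom).left = Ξ ∧ Ξ.comap (X ◁ e.inv).left = Ξ' := by
  refine ⟨⟨h'.lift H Ξ h.mem, h.lift H' Ξ' h'.mem, ?_, ?_⟩, h'.comap_lift H Ξ h.mem,
    h.comap_lift H' Ξ' h'.mem⟩
  · apply h.hom_ext
    rw [comap_whiskerLeft_comp, h.comap_lift, h'.comap_lift, comap_whiskerLeft_id]
  · apply h'.hom_ext
    rw [comap_whiskerLeft_comp, h'.comap_lift, h.comap_lift, comap_whiskerLeft_id]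

end IsHilbertSchemeOfPoints

/-! ### Non-vacuity: `Hilb^0_{X/B}` is represented by `B` with the empty family -/

/-- A morphism out of an empty scheme is an open immersion (its underlying map is an open
embedding and there are no stalks to check). [folklore] -/
theorem isOpenImmersion_of_isEmpty {Z T : Scheme.{u}} (p : Z ⟶ T) [IsEmpty Z] :
    IsOpenImmersion p :=
  haveI : ∀ x : Z, IsIso (p.stalkMap x) := fun x ↦ isEmptyElim x
  IsOpenImmersion.of_isIso_stalkMap p (Topology.IsOpenEmbedding.of_isEmpty _)

/-- The rank function of a morphism out of an empty scheme vanishes identically (locally on the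
target it is the base change of `Spec 0 → Spec R`, whose rank is the rank of the zero module).
[cite: StacksProject, Tag 02KA] -/
theorem finrank_eq_zero_of_isEmpty {Z T : Scheme.{u}} (p : Z ⟶ T) [IsEmpty Z] (t : T) :
    p.finrank t = 0 := by
  haveI := isOpenImmersion_of_isEmpty p
  obtain ⟨R, g, -, y, rfl⟩ := Scheme.exists_Spec_apply_eq t
  rw [← Scheme.Hom.finrank_pullback_snd p g y]
  haveI : IsEmpty ↑(pullback p g) := Function.isEmpty (pullback.fst p g)
  set q := pullback.snd p g
  let φ : R ⟶ CommRingCat.of PUnit.{u + 1} := CommRingCat.ofHom (algebraMap R PUnit)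
  haveI : IsEmpty ↑(Spec (CommRingCat.of PUnit.{u + 1})) := inferInstance
  haveI := isOpenImmersion_of_isEmpty (Spec.map φ)
  let e : pullback p g ⟶ Spec (CommRingCat.of PUnit.{u + 1}) := isInitialOfIsEmpty.to _
  have sq : IsPullback e q (Spec.map φ) (𝟙 _) :=
    IsPullback.of_horiz_isIso ⟨isInitialOfIsEmpty.hom_ext _ _⟩
  rw [Scheme.Hom.finrank_of_isPullback e q (Spec.map φ) (𝟙 _) sq y]
  change Scheme.Hom.finrank (Spec.map (CommRingCat.ofHom (algebraMap R PUnit))) y = 0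
  rw [Scheme.Hom.finrank_SpecMap_algebraMap, Module.rankAtStalk_eq_zero_of_subsingleton]
  rfl

/-- A morphism out of an empty scheme is finite locally free of rank `0`.
[cite: StacksProject, Tag 02KA and Tag 02KB] -/
theorem isFiniteLocallyFreeOfRank_zero_of_isEmpty {Z T : Scheme.{u}} (p : Z ⟶ T) [IsEmpty Z] :
    IsFiniteLocallyFreeOfRank 0 p :=
  haveI := isOpenImmersion_of_isEmpty p
  ⟨inferInstance, inferInstance, inferInstance, finrank_eq_zero_of_isEmpty p⟩

/-- Conversely, a morphism which is finite locally free of rank `0` has empty source (the rank at a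
point of the image is `≥ 1`, Mathlib `Scheme.Hom.one_le_finrank_map`).
[cite: StacksProject, Tag 02KA] -/
theorem IsFiniteLocallyFreeOfRank.isEmpty {Z T : Scheme.{u}} {p : Z ⟶ T}
    (h : IsFiniteLocallyFreeOfRank 0 p) : IsEmpty Z := by
  haveI := h.isFinite
  haveI := h.flat
  refine ⟨fun z ↦ ?_⟩
  have h1 := Scheme.Hom.one_le_finrank_map p z
  rw [h.finrank_eq] at h1
  exact Nat.not_succ_le_zero 0 h1

/-- The empty subscheme `∅ ⊂ X_T` (the ideal `⊤`) is a `T`-point of `Hilb^0_{X/B}`.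
[cite: StacksProject, Tag 0B94] -/
theorem top_mem_hilbertFunctorOfPoints_zero (X T : Over B) :
    (⊤ : (X ⊗ T).left.IdealSheafData) ∈ hilbertFunctorOfPoints 0 X T :=
  isFiniteLocallyFreeOfRank_zero_of_isEmpty _

/-- `Hilb^0_{X/B}(T) = {∅}`: a closed subscheme of `X_T` finite locally free of degree `0` over `T`
is empty, i.e. its ideal is `⊤`. [cite: StacksProject, Tag 0B94] -/
theorem mem_hilbertFunctorOfPoints_zero_iff {X T : Over B} (I : (X ⊗ T).left.IdealSheafData) :
    I ∈ hilbertFunctorOfPoints 0 X T ↔ I = ⊤ := by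
  refine ⟨fun hI ↦ ?_, fun h ↦ h ▸ top_mem_hilbertFunctorOfPoints_zero X T⟩
  haveI : IsEmpty ↑I.subscheme := IsFiniteLocallyFreeOfRank.isEmpty hI
  rw [← Scheme.IdealSheafData.support_eq_bot_iff]
  ext x
  simp only [TopologicalSpace.Closeds.coe_bot, Set.mem_empty_iff_false, iff_false]
  intro hx
  rw [← Scheme.IdealSheafData.range_subschemeι] at hx
  obtain ⟨z, -⟩ := hx
  exact isEmptyElim z

/-- **`Hilb^0_{X/B} = B`** (non-vacuity of `IsHilbertSchemeOfPoints`): the terminal `B`-scheme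
`B = 𝟙_ (Over B)` together with the empty family `⊤ ⊂ X ×_B B` represents the Hilbert functor of
`0` points of any `X → B` — every `T` carries exactly one family of degree `0` (the empty one) and
exactly one `B`-morphism to `B`. [cite: StacksProject, Tag 0B94] -/
theorem isHilbertSchemeOfPoints_zero (X : Over B) :
    IsHilbertSchemeOfPoints 0 X (𝟙_ (Over B)) ⊤ where
  mem := top_mem_hilbertFunctorOfPoints_zero X _
  existsUnique_hom T I hI := by
    refine ⟨CartesianMonoidalCategory.toUnit T, ?_,
      fun g _ ↦ CartesianMonoidalCategory.toUnit_unique _ _⟩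
    dsimp only
    rw [Scheme.IdealSheafData.comap_top, eq_comm]
    exact (mem_hilbertFunctorOfPoints_zero_iff I).mp hI

end Literature.AlgebraicGeometry.HilbertScheme
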